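import Literature.Topology.FourManifolds.LatticeFormsNegTwoVectorOrbits
import Literature.Topology.FourManifolds.LatticeFormsRankOneDiscriminantFormUnitCount
import HarnessLib

/-!
# The number of `Õ`-orbits of `(−2d)`-vectors in `L_{2d}^{(m)} = 2U ⊕ mE₈(−1) ⊕ ⟨−2d⟩`
# (Gritsenko–Hulek–Sankaran, *Hirzebruch–Mumford proportionality and locally symmetric varieties of orthogonal
# type*, Doc. Math. 13 (2008), Prop. 2.4 (iv))

Trunk T-4MAN vocabulary; sequel of `LatticeFormsNegTwoVectorOrbits.lean` (row g41-#1: Prop. 2.4 (i)–(ii), the abstract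
lattice `L = B₀ ⊕ ⟨−2d⟩` with `B₀` symmetric even unimodular containing two orthogonal hyperbolic pairs
`TwoHyperbolicPairs B₀ x y x₁ y₁`, its evaluation `prod_neg_twoMul_smul_mul_apply`, `TwoHyperbolicPairs.inl`, and the
model `L_{2d}^{(m)} = (E₈(−1)^{⊕m} ⊕ U^{⊕2}) ⊕ ℤ(−2d)`), of `LatticeFormsEichlerCriterionDivisor.lean` (the Eichler
criterion with divisor, `u* = u/d ∈ L^∨`, `u ≡ v (mod dL) ⟺ [u*] = [v*]`, `E_U ⊂ Õ(L)`), of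
`LatticeFormsDiscriminantFormIsometry.lean` (`ḡ = IsometryEquiv.discriminantGroupCongr`) and of the counting files
`LatticeFormsRankOneDiscriminantFormIsometries.lean` ∕ `…UnitCount.lean` (g39: `#{u mod 2n : u² ≡ 1 (4n)} = 2^{ω(n)}`,
`#{x mod 4n : x² = 1} = 2^{ω(n)+1}`, `#{y mod m : y² = 1} = 2^{ω(m)}` for odd `m`). Written for lane `lit-hodgefound`
(Track 2 foundations; prover seat `lit-hodgefound-p18`, gen 41, row g41-#2). THEOREMS ONLY — no definition, no named
fact, no instance, no notation.

## Source, verbatim (V. Gritsenko, K. Hulek, G. K. Sankaran, Doc. Math. 13 (2008) 1–19, §2, held text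
`paper:arxiv-math_0609774` p. 6)

"**Proposition 2.4.** Suppose `d` is a positive integer. […] (iv) Suppose `d > 1`. The number of
`Õ(L_{2d}^{(m)})`-orbits of `(−2d)`-vectors with `div(r) = 2d` is `2^{ρ(d)}`. The number of `Õ(L_{2d}^{(m)})`-orbits of
`(−2d)`-vectors with `div(r) = d` is `2^{ρ(d)}` if `d` is odd or `d ≡ 4 mod 8`; `2^{ρ(d)+1}` if `d ≡ 0 mod 8`;
`2^{ρ(d)−1}` if `d ≡ 2 mod 4`. Here `ρ(d)` is the number of prime divisors of `d`.
*Proof.* If the lattice `L` contains two hyperbolic planes then according to the well-known result of Eichler (see [E])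
the `Õ⁺(L)`-orbit of a primitive vector `l ∈ L` is completely defined by two invariants: by its length `(l,l)` and by
its image `l* + L` in the discriminant group `A_L`, where `l* = l/div(l)`. […] iv) To find the number of orbits of
`(−2d)`-vectors we have to consider two cases. a) Let `div(r) = 2d`. Then `r = 2du + xh` and `r* ≡ (x/2d)h mod L`,
where `u ∈ II_{2,8m+2}` and `x` is modulo `2d`. Moreover `(r,r) = 4d²(u,u) − x²2d = −2d`. Thus `x² ≡ 1 mod 4d`. This
congruence has `2^{ρ(d)}` solutions modulo `2d`. For any such `x mod 2d` we can find a vector `u` in `2U ⊕ mE₈(−1)`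
with `(u,u) = (x²−1)/2d`. Then `r = 2du + xh` is primitive (because `u` is not divisible by any divisor of `x`) and
`(r,r) = −2d`. b) Let `div(r) = d`. Then `r = du + xh`, where `u` is primitive, `r* ≡ (x/d)h mod L` and `x` is modulo
`d`. We have `(r*,r*) ≡ −2x²/d mod 2ℤ` and `x² ≡ 1 mod d`. For any solution modulo `d` we can find as above
`u ∈ 2U ⊕ mE₈(−1)` such that `r = du + xh` is primitive and `(r,r) = −2d`. It is easy to see that the number of
solutions `{x mod d | x² ≡ 1 mod d}` is as stated. □"

## Reading notes

* "`(−2d)`-vector `r` with `div(r) = δ`" (`δ = 2d` or `d`) is formalised as: `(r,r) = −2d`, `δ ∣ (r, z)` for all `z`,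
  and `(r, r') = δ` for some `r'` (so `(r, L) = δℤ`). For these two values of `δ` this already forces `r` to be
  primitive (if `r = pr₀` then `(r₀, L) = (δ/p)ℤ`, `(r₀)² = −2d/p²`, and `div(r₀) ∣ (r₀)²` leaves only `p = 2`,
  `δ = d`, `(r₀)² = −d/2 = −δ/2`, impossible in an even `B₀ ⊕ ⟨−2d⟩` since then `r₀ = (δ/2)u₁ + x₀h` gives
  `(δ/2)u₁²` odd), so primitivity is not a separate hypothesis; this remark is not itself needed below.
* GROUPS. As printed, for `Õ(L) = {g ∈ O(L) : ḡ = id on A_L}`: "⟸" (same invariants ⟹ same orbit) is the tree's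
  Eichler criterion, whose words lie in `Õ` (`UGen.discriminantGroupCongr_evalEquiv`); "⟹" is `ḡ = id ⟹
  [(gr)*] = ḡ[r*] = [r*]` (§1). The proof quotes the criterion for `Õ⁺`; TODO(general form): `Õ⁺`-counts (the same,
  once the spinor norm is in the tree).
* The hypothesis `d > 1` is not used by the printed argument and is dropped (`d ≥ 1`); for `d = 1` both counts are `1`.
* ABSTRACTION as in g41-#1: everything is proved for `L = B₀ ⊕ ⟨−2d⟩`, `B₀` symmetric even unimodular with two
  orthogonal hyperbolic pairs, then specialised to the model `L_{2d}^{(m)}` (`m = 2`: the tree's `L_{2d}`).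
* The count in b) is obtained as a bijection with `{x : ℤ/d // x² = 1}` (§3) followed by the evaluation of
  `#{x mod d : x² ≡ 1 (d)}` in the four printed cases (§4: odd — the tree's `natCard_sq_eq_one_zmod_of_odd`;
  `d ≡ 2 (4)` by `ℤ/2m ≃ ℤ/2 × ℤ/m`; `4 ∣ d` by the tree's `natCard_sq_eq_one_zmod_four_mul` with `n = d/4` odd ∕ even).

## Contents (all proved)

* §1 `exists_smul_eq_apply_sub_of_discriminantGroupCongr_eq_refl` (`Õ` fixes `l* + L`: `gl ≡ l (mod δL)`, any
  nondegenerate lattice); in `B₀ ⊕ ⟨−2d⟩`: `exists_fst_eq_smul_of_forall_dvd` (`δ ∣ div(r) ⟹ u ∈ δB₀`),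
  `dvd_snd_apply_sub_snd_of_discriminantGroupCongr_eq_refl` (`x_{gr} ≡ x_r (mod δ)`), the Eichler criterion for
  vectors with `δ ∣ div` attained (`exists_uGens_apply_eq_of_dvd_snd_sub_snd`) and the resulting description of the
  `Õ`-orbit **`exists_stable_isometryEquiv_apply_eq_iff_dvd_snd_sub_snd`** (same square, `(·, L) = δℤ`:
  `u ~ v ⟺ x_u ≡ x_v (mod δ)`).
* §2 `four_mul_dvd_snd_sq_sub_one` (`div = 2d ⟹ x² ≡ 1 (4d)`), `dvd_snd_sq_sub_one` (`div = d ⟹ x² ≡ 1 (d)`), and the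
  existence of `r = δ(e + tf) + xh` for every solution (`exists_snd_eq_and_apply_self_eq_neg_of_four_mul_dvd`,
  `exists_snd_eq_and_apply_self_eq_neg_of_dvd`).
* §3 **`natCard_quot_stable_isometryEquiv_neg_twoMul_of_divisor_twoMul`** (`div = 2d`: `#orbits = 2^{ρ(d)}`) and
  **`natCard_quot_stable_isometryEquiv_neg_twoMul_of_divisor`** (`div = d`: `#orbits = #{x : ℤ/d // x² = 1}`).
* §4 `natCard_sq_eq_one_zmod_two`, **`natCard_sq_eq_one_zmod_of_mod_four_eq_two`** (`2^{ρ(d)−1}`),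
  **`natCard_sq_eq_one_zmod_of_mod_eight_eq_four`** (`2^{ρ(d)}`), **`natCard_sq_eq_one_zmod_of_eight_dvd`**
  (`2^{ρ(d)+1}`), `natCard_sq_eq_one_zmod_of_odd'` (`2^{ρ(d)}`).
* §5 the model: `natCard_quot_stable_isometryEquiv_latticeL2dm_neg_twoMul_of_divisor_twoMul`,
  `natCard_quot_stable_isometryEquiv_latticeL2dm_neg_twoMul_of_divisor`.

## References

* [GritsenkoHulekSankaran2008Proportionality] V. Gritsenko, K. Hulek, G. K. Sankaran, Hirzebruch–Mumford
  proportionality and locally symmetric varieties of orthogonal type, Doc. Math. 13 (2008) 1–19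
  (arXiv:math/0609774): §2 Prop. 2.4 (iv) and proof.
* [GritsenkoHulekSankaran2009] V. Gritsenko, K. Hulek, G. K. Sankaran, Abelianisation of orthogonal groups and the
  fundamental group of modular varieties, J. Algebra 322 (2009): §3.3, Prop. 3.3 (i) (Eichler criterion).
* [GritsenkoHulekSankaran2007HM] V. Gritsenko, K. Hulek, G. K. Sankaran, The Hirzebruch–Mumford volume for the
  orthogonal group and applications, Doc. Math. 12 (2007): §4 proof of Lemma 4.3 (`x² ≡ 1 mod 4d` has `2^{ρ(d)}`
  solutions modulo `2d`).
* [Oguiso2002K3AlmostPrimes] K. Oguiso, K3 surfaces via almost-primes, Math. Res. Lett. 9 (2002): Lemma 4.5,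
  Prop. 1.10 (the counting by the Chinese remainder theorem).
-/

noncomputable section

open Module Function
open LinearMap (BilinForm)
open LinearMap.BilinForm

namespace Literature.Topology.FourManifolds

universe u

/-! ### §1 `Õ(L)` preserves `l* + L`; the Eichler criterion with divisor `δ` in `B₀ ⊕ ⟨−2d⟩` -/

section Stable

/-- **`Õ(L)` fixes `l* + L`**: if `g ∈ O(L)` acts as the identity on `A_L = L^∨/L` and `δ ∣ (l, z)` for all `z`
(`l* = l/δ ∈ L^∨`), then `g l ≡ l (mod δL)` — since `[(gl)*] = ḡ[l*] = [l*]`. (`L` nondegenerate, `δ ≠ 0`.)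
[cite: GritsenkoHulekSankaran2008Proportionality, §2 proof of Prop. 2.4 ("the `Õ⁺(L)`-orbit of a primitive vector `l ∈ L` is completely defined by two invariants: by its length `(l,l)` and by its image `l* + L` in the discriminant group `A_L`, where `l* = l/div(l)`")] [cite: GritsenkoHulekSankaran2009, §3.3] -/
theorem exists_smul_eq_apply_sub_of_discriminantGroupCongr_eq_refl {W : Type*} [AddCommGroup W]
    {B : BilinForm ℤ W} (hB : B.Nondegenerate) (g : B.IsometryEquiv B)
    (hg : g.discriminantGroupCongr = LinearEquiv.refl ℤ _) {l : W} {δ : ℤ} (hδ : δ ≠ 0)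
    (h : ∀ z, δ ∣ B l z) : ∃ w : W, δ • w = g l - l := by
  obtain ⟨f, hf⟩ := exists_dual_smul_eq_of_forall_dvd B h
  have hf' : δ • (g : W ≃ₗ[ℤ] W).symm.dualMap f = B (g l) := by
    rw [← map_zsmul, hf, g.symm_dualMap_apply_apply]
  have hcl : (Submodule.Quotient.mk ((g : W ≃ₗ[ℤ] W).symm.dualMap f) : B.discriminantGroup) =
      Submodule.Quotient.mk f := by
    rw [← g.discriminantGroupCongr_mk, hg, LinearEquiv.refl_apply]
  exact (exists_smul_eq_sub_iff_mk_eq_mk hB hδ hf' hf).2 hcl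

variable {M : Type u} [AddCommGroup M] {B₀ : BilinForm ℤ M} (d : ℕ)

/-- **"If `f ∣ div(r)` then the vector `u` is also divisible by `f`"**: for `r = u + xh ∈ B₀ ⊕ ⟨−2d⟩` with `δ ∣ (r, z)`
for all `z` and `B₀` unimodular, `u ∈ δB₀`. [cite: GritsenkoHulekSankaran2008Proportionality, Prop. 2.4 (ii) proof ("If `f ∣ div(r)`, where `f = 2`, `d` or `2d`, then the vector `u` is also divisible by `f`")] -/
theorem exists_fst_eq_smul_of_forall_dvd (hu : B₀.IsUnimodular) {r : M × ℤ} {δ : ℤ}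
    (h : ∀ z, δ ∣ B₀.prod ((-(2 * d : ℤ)) • LinearMap.mul ℤ ℤ) r z) : ∃ u₀ : M, r.1 = δ • u₀ := by
  haveI : B₀.IsPerfPair := hu
  refine exists_eq_smul_of_forall_dvd (B := B₀) fun v ↦ ?_
  have h1 := h (v, 0)
  rwa [prod_neg_twoMul_smul_mul_apply, mul_zero, mul_zero, sub_zero] at h1

/-- In `B₀ ⊕ ⟨−2d⟩`: `Õ`-equivalent vectors with `δ ∣ (r, L)` have congruent `h`-coordinates modulo `δ` ("`x` is
modulo `2d`" ∕ "`x` is modulo `d`"). [cite: GritsenkoHulekSankaran2008Proportionality, Prop. 2.4 (iv) proof ("`r* ≡ (x/2d)h mod L` … and `x` is modulo `2d`")] -/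
theorem dvd_snd_apply_sub_snd_of_discriminantGroupCongr_eq_refl (hu : B₀.IsUnimodular) (hd : 0 < d)
    (g : (B₀.prod ((-(2 * d : ℤ)) • LinearMap.mul ℤ ℤ)).IsometryEquiv (B₀.prod ((-(2 * d : ℤ)) • LinearMap.mul ℤ ℤ)))
    (hg : g.discriminantGroupCongr = LinearEquiv.refl ℤ _) {r : M × ℤ} {δ : ℤ} (hδ : δ ≠ 0)
    (h : ∀ z, δ ∣ B₀.prod ((-(2 * d : ℤ)) • LinearMap.mul ℤ ℤ) r z) : δ ∣ (g r).2 - r.2 := by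
  obtain ⟨w, hw⟩ := exists_smul_eq_apply_sub_of_discriminantGroupCongr_eq_refl
    (nondegenerate_prod_neg_twoMul_smul_mul B₀ d hu hd) g hg hδ h
  exact ⟨w.2, by rw [← Prod.snd_sub, ← hw, Prod.smul_snd, smul_eq_mul]⟩

/-- **The Eichler criterion in `B₀ ⊕ ⟨−2d⟩` for vectors with `δ ∣ div`**: `B₀` even unimodular with two orthogonal
hyperbolic pairs; if `u, v` have the same square, `δ` divides all their products and is attained
(`(u,u') = (v,v') = δ`), and their `h`-coordinates agree modulo `δ`, then an admissible Eichler word carries `u` to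
`v` — for `u = δu₀ + sh`, `v = δv₀ + th` give `u ≡ v (mod δL)`, i.e. `u* ≡ v* (mod L)`.
[cite: GritsenkoHulekSankaran2008Proportionality, Prop. 2.4 (iv) proof] [cite: GritsenkoHulekSankaran2009, Prop. 3.3 (i)] -/
theorem exists_uGens_apply_eq_of_dvd_snd_sub_snd (hu : B₀.IsUnimodular) (he : B₀.IsEven) {x y x₁ y₁ : M}
    (h : TwoHyperbolicPairs B₀ x y x₁ y₁) {u v u' v' : M × ℤ} {δ : ℤ}
    (huv : B₀.prod ((-(2 * d : ℤ)) • LinearMap.mul ℤ ℤ) u u = B₀.prod ((-(2 * d : ℤ)) • LinearMap.mul ℤ ℤ) v v)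
    (hdu : ∀ z, δ ∣ B₀.prod ((-(2 * d : ℤ)) • LinearMap.mul ℤ ℤ) u z)
    (hdv : ∀ z, δ ∣ B₀.prod ((-(2 * d : ℤ)) • LinearMap.mul ℤ ℤ) v z)
    (hu' : B₀.prod ((-(2 * d : ℤ)) • LinearMap.mul ℤ ℤ) u u' = δ)
    (hv' : B₀.prod ((-(2 * d : ℤ)) • LinearMap.mul ℤ ℤ) v v' = δ) (hst : δ ∣ u.2 - v.2) :
    ∃ l : List (UGen (M × ℤ)),
      (∀ g ∈ l, g.IsAdmissible (B₀.prod ((-(2 * d : ℤ)) • LinearMap.mul ℤ ℤ)) (x, 0) (y, 0)) ∧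
        UGen.eval (B₀.prod ((-(2 * d : ℤ)) • LinearMap.mul ℤ ℤ)) (x, 0) (y, 0) l u = v := by
  obtain ⟨u₀, hu₀⟩ := exists_fst_eq_smul_of_forall_dvd d hu hdu
  obtain ⟨v₀, hv₀⟩ := exists_fst_eq_smul_of_forall_dvd d hu hdv
  obtain ⟨c, hc⟩ := hst
  refine (h.inl (isSymm_smul_mul _)).exists_uGens_apply_eq_of_smul_eq_sub
    (isSymm_isEven_prod_neg_twoMul_smul_mul B₀ d h.isSymm he).2 huv hdu hu' hv' (w := (u₀ - v₀, c))
    (Prod.ext ?_ ?_)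
  · change δ • (u₀ - v₀) = u.1 - v.1
    rw [smul_sub, ← hu₀, ← hv₀]
  · change δ • c = u.2 - v.2
    rw [smul_eq_mul, ← hc]

variable [Module.Finite ℤ M] [Module.Free ℤ M]

/-- **The `Õ(B₀ ⊕ ⟨−2d⟩)`-orbit of a vector with `δ ∣ div`, attained, is determined by its square and its
`h`-coordinate modulo `δ`** (both directions: `E_U ⊂ Õ` gives "⟸", `Õ` fixes `r* + L` gives "⟹").
[cite: GritsenkoHulekSankaran2008Proportionality, Prop. 2.4 (iv) proof] [cite: GritsenkoHulekSankaran2009, Prop. 3.3 (i), §3.3] -/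
theorem exists_stable_isometryEquiv_apply_eq_iff_dvd_snd_sub_snd (hu : B₀.IsUnimodular) (he : B₀.IsEven)
    (hd : 0 < d) {x y x₁ y₁ : M} (h : TwoHyperbolicPairs B₀ x y x₁ y₁) {u v u' v' : M × ℤ} {δ : ℤ} (hδ : δ ≠ 0)
    (huv : B₀.prod ((-(2 * d : ℤ)) • LinearMap.mul ℤ ℤ) u u = B₀.prod ((-(2 * d : ℤ)) • LinearMap.mul ℤ ℤ) v v)
    (hdu : ∀ z, δ ∣ B₀.prod ((-(2 * d : ℤ)) • LinearMap.mul ℤ ℤ) u z)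
    (hdv : ∀ z, δ ∣ B₀.prod ((-(2 * d : ℤ)) • LinearMap.mul ℤ ℤ) v z)
    (hu' : B₀.prod ((-(2 * d : ℤ)) • LinearMap.mul ℤ ℤ) u u' = δ)
    (hv' : B₀.prod ((-(2 * d : ℤ)) • LinearMap.mul ℤ ℤ) v v' = δ) :
    (∃ g : (B₀.prod ((-(2 * d : ℤ)) • LinearMap.mul ℤ ℤ)).IsometryEquiv (B₀.prod ((-(2 * d : ℤ)) • LinearMap.mul ℤ ℤ)),
      g.discriminantGroupCongr = LinearEquiv.refl ℤ _ ∧ g u = v) ↔ δ ∣ u.2 - v.2 := by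
  constructor
  · rintro ⟨g, hg, hguv⟩
    have h1 := dvd_snd_apply_sub_snd_of_discriminantGroupCongr_eq_refl d hu hd g hg hδ hdu
    rw [hguv] at h1
    rwa [dvd_sub_comm] at h1
  · intro hst
    obtain ⟨l, hl, hluv⟩ := exists_uGens_apply_eq_of_dvd_snd_sub_snd d hu he h huv hdu hdv hu' hv' hst
    have hL := h.inl (S := (-(2 * d : ℤ)) • LinearMap.mul ℤ ℤ) (isSymm_smul_mul _)
    exact ⟨UGen.evalEquiv hL.isSymm hL.xx hL.yy l hl,
      UGen.discriminantGroupCongr_evalEquiv (nondegenerate_prod_neg_twoMul_smul_mul B₀ d hu hd) hL.isSymm hL.xx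
        hL.yy l hl,
      by rw [UGen.evalEquiv_apply, hluv]⟩

end Stable

/-! ### §2 The `h`-coordinate of a `(−2d)`-vector: `x² ≡ 1 (mod 4d)` resp. `(mod d)`; existence -/

section Arithmetic

variable {M : Type u} [AddCommGroup M] {B₀ : BilinForm ℤ M} (d : ℕ)

/-- **"Let `div(r) = 2d`. Then `r = 2du + xh` … `(r,r) = 4d²(u,u) − x²2d = −2d`. Thus `x² ≡ 1 mod 4d`."**
[cite: GritsenkoHulekSankaran2008Proportionality, Prop. 2.4 (iv) proof, a)] -/
theorem four_mul_dvd_snd_sq_sub_one (hu : B₀.IsUnimodular) (he : B₀.IsEven) (hd : 0 < d) {r : M × ℤ}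
    (hr : B₀.prod ((-(2 * d : ℤ)) • LinearMap.mul ℤ ℤ) r r = -(2 * d : ℤ))
    (h : ∀ z, (2 * d : ℤ) ∣ B₀.prod ((-(2 * d : ℤ)) • LinearMap.mul ℤ ℤ) r z) : (4 * d : ℤ) ∣ r.2 ^ 2 - 1 := by
  obtain ⟨u₀, hu₀⟩ := exists_fst_eq_smul_of_forall_dvd d hu h
  obtain ⟨t, ht⟩ := he u₀
  rw [prod_neg_twoMul_smul_mul_apply, hu₀, map_zsmul, map_zsmul, LinearMap.smul_apply, smul_eq_mul, smul_eq_mul,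
    ht] at hr
  have h1 : (2 * d : ℤ) * (2 * d * (t + t) - r.2 * r.2 + 1) = 0 := by linarith
  have h2 : 2 * d * (t + t) - r.2 * r.2 + 1 = 0 :=
    (mul_eq_zero.1 h1).resolve_left (by exact_mod_cast (by omega : 2 * d ≠ 0))
  exact ⟨t, by linarith [sq r.2]⟩

/-- **"Let `div(r) = d`. Then `r = du + xh` … `x² ≡ 1 mod d`."**
[cite: GritsenkoHulekSankaran2008Proportionality, Prop. 2.4 (iv) proof, b)] -/
theorem dvd_snd_sq_sub_one (hu : B₀.IsUnimodular) (he : B₀.IsEven) (hd : 0 < d) {r : M × ℤ}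
    (hr : B₀.prod ((-(2 * d : ℤ)) • LinearMap.mul ℤ ℤ) r r = -(2 * d : ℤ))
    (h : ∀ z, (d : ℤ) ∣ B₀.prod ((-(2 * d : ℤ)) • LinearMap.mul ℤ ℤ) r z) : (d : ℤ) ∣ r.2 ^ 2 - 1 := by
  obtain ⟨u₀, hu₀⟩ := exists_fst_eq_smul_of_forall_dvd d hu h
  obtain ⟨t, ht⟩ := he u₀
  rw [prod_neg_twoMul_smul_mul_apply, hu₀, map_zsmul, map_zsmul, LinearMap.smul_apply, smul_eq_mul, smul_eq_mul,
    ht] at hr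
  have h1 : (2 * d : ℤ) * (d * t - r.2 * r.2 + 1) = 0 := by linarith
  have h2 : (d : ℤ) * t - r.2 * r.2 + 1 = 0 :=
    (mul_eq_zero.1 h1).resolve_left (by exact_mod_cast (by omega : 2 * d ≠ 0))
  exact ⟨t, by linarith [sq r.2]⟩

/-- **"For any such `x mod 2d` we can find a vector `u` in `2U ⊕ mE₈(−1)` with `(u,u) = (x²−1)/2d`. Then `r = 2du + xh`
is primitive … and `(r,r) = −2d`"**: here `u = e + tf` with `x² − 1 = 4dt`, so `(u,u) = 2t`, `(r, f) = 2d`.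
[cite: GritsenkoHulekSankaran2008Proportionality, Prop. 2.4 (iv) proof, a)] -/
theorem exists_snd_eq_and_apply_self_eq_neg_of_four_mul_dvd {x y x₁ y₁ : M} (h : TwoHyperbolicPairs B₀ x y x₁ y₁)
    {ξ : ℤ} (hξ : (4 * d : ℤ) ∣ ξ ^ 2 - 1) :
    ∃ r r' : M × ℤ, r.2 = ξ ∧ B₀.prod ((-(2 * d : ℤ)) • LinearMap.mul ℤ ℤ) r r = -(2 * d : ℤ) ∧
      B₀.prod ((-(2 * d : ℤ)) • LinearMap.mul ℤ ℤ) r r' = 2 * d ∧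
        ∀ z, (2 * d : ℤ) ∣ B₀.prod ((-(2 * d : ℤ)) • LinearMap.mul ℤ ℤ) r z := by
  obtain ⟨t, ht⟩ := hξ
  refine ⟨((2 * d : ℤ) • (x + t • y), ξ), (y, 0), rfl, ?_, ?_, fun z ↦ ?_⟩
  · rw [prod_neg_twoMul_smul_mul_apply]
    dsimp only
    simp only [map_add, map_zsmul, LinearMap.add_apply, LinearMap.smul_apply, smul_eq_mul, h.xx, h.yy, h.xy,
      h.isSymm.eq y x]
    linear_combination (-(2 * d : ℤ)) * ht
  · rw [prod_neg_twoMul_smul_mul_apply]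
    dsimp only
    simp only [map_add, map_zsmul, LinearMap.add_apply, LinearMap.smul_apply, smul_eq_mul, h.yy, h.xy]
    ring
  · rw [prod_neg_twoMul_smul_mul_apply]
    dsimp only
    simp only [map_add, map_zsmul, LinearMap.add_apply, LinearMap.smul_apply, smul_eq_mul]
    exact ⟨B₀ x z.1 + t * B₀ y z.1 - ξ * z.2, by ring⟩

/-- **"Let `div(r) = d` … For any solution modulo `d` we can find as above `u ∈ 2U ⊕ mE₈(−1)` such that `r = du + xh`
is primitive and `(r,r) = −2d`"**: `u = e + tf` with `x² − 1 = dt`, `(r, f) = d`.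
[cite: GritsenkoHulekSankaran2008Proportionality, Prop. 2.4 (iv) proof, b)] -/
theorem exists_snd_eq_and_apply_self_eq_neg_of_dvd {x y x₁ y₁ : M} (h : TwoHyperbolicPairs B₀ x y x₁ y₁)
    {ξ : ℤ} (hξ : (d : ℤ) ∣ ξ ^ 2 - 1) :
    ∃ r r' : M × ℤ, r.2 = ξ ∧ B₀.prod ((-(2 * d : ℤ)) • LinearMap.mul ℤ ℤ) r r = -(2 * d : ℤ) ∧
      B₀.prod ((-(2 * d : ℤ)) • LinearMap.mul ℤ ℤ) r r' = d ∧
        ∀ z, (d : ℤ) ∣ B₀.prod ((-(2 * d : ℤ)) • LinearMap.mul ℤ ℤ) r z := by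
  obtain ⟨t, ht⟩ := hξ
  refine ⟨((d : ℤ) • (x + t • y), ξ), (y, 0), rfl, ?_, ?_, fun z ↦ ?_⟩
  · rw [prod_neg_twoMul_smul_mul_apply]
    dsimp only
    simp only [map_add, map_zsmul, LinearMap.add_apply, LinearMap.smul_apply, smul_eq_mul, h.xx, h.yy, h.xy,
      h.isSymm.eq y x]
    linear_combination (-(2 * d : ℤ)) * ht
  · rw [prod_neg_twoMul_smul_mul_apply]
    dsimp only
    simp only [map_add, map_zsmul, LinearMap.add_apply, LinearMap.smul_apply, smul_eq_mul, h.yy, h.xy]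
    ring
  · rw [prod_neg_twoMul_smul_mul_apply]
    dsimp only
    simp only [map_add, map_zsmul, LinearMap.add_apply, LinearMap.smul_apply, smul_eq_mul]
    exact ⟨B₀ x z.1 + t * B₀ y z.1 - 2 * ξ * z.2, by ring⟩

end Arithmetic

/-! ### §3 The orbit sets are in bijection with `{x mod 2d : x² ≡ 1 (4d)}` resp. `{x mod d : x² ≡ 1 (d)}` -/

section Count

variable {M : Type u} [AddCommGroup M] [Module.Finite ℤ M] [Module.Free ℤ M] {B₀ : BilinForm ℤ M} (d : ℕ)

/-- `x² ≡ 1 (mod 4d)` is a condition on `x mod 2d` (read on the canonical lift).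
[cite: GritsenkoHulekSankaran2008Proportionality, Prop. 2.4 (iv) proof ("This congruence has `2^{ρ(d)}` solutions modulo `2d`")] -/
theorem four_mul_dvd_val_intCast_sq_sub_one_iff (hd : 0 < d) (ξ : ℤ) :
    (4 * d : ℤ) ∣ (((ξ : ZMod (2 * d))).val : ℤ) ^ 2 - 1 ↔ (4 * d : ℤ) ∣ ξ ^ 2 - 1 := by
  haveI : NeZero (2 * d) := ⟨by omega⟩
  refine four_mul_dvd_sq_sub_one_iff_of_eq_add d (r := ξ) (q := -(ξ / (2 * d : ℕ))) ?_
  rw [ZMod.val_intCast, Int.emod_def]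
  push_cast
  ring

/-- **GHS Prop. 2.4 (iv), `div(r) = 2d`: the `Õ(B₀ ⊕ ⟨−2d⟩)`-orbits of `(−2d)`-vectors `r` with `(r, L) = 2dℤ` are in
bijection with `{x mod 2d : x² ≡ 1 mod 4d}` via the `h`-coordinate, hence number `2^{ρ(d)}`** (`B₀` even unimodular
with two orthogonal hyperbolic pairs, `d ≥ 1`; `ρ(d)` = the number of prime divisors of `d`).
[cite: GritsenkoHulekSankaran2008Proportionality, Prop. 2.4 (iv) ("The number of `Õ(L_{2d}^{(m)})`-orbits of `(−2d)`-vectors with `div(r) = 2d` is `2^{ρ(d)}`")] -/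
theorem natCard_quot_stable_isometryEquiv_neg_twoMul_of_divisor_twoMul (hu : B₀.IsUnimodular) (he : B₀.IsEven)
    (hd : 0 < d) {x y x₁ y₁ : M} (h : TwoHyperbolicPairs B₀ x y x₁ y₁) :
    Nat.card (Quot fun r s : {r : M × ℤ // B₀.prod ((-(2 * d : ℤ)) • LinearMap.mul ℤ ℤ) r r = -(2 * d : ℤ) ∧
        (∀ z, (2 * d : ℤ) ∣ B₀.prod ((-(2 * d : ℤ)) • LinearMap.mul ℤ ℤ) r z) ∧
          ∃ r', B₀.prod ((-(2 * d : ℤ)) • LinearMap.mul ℤ ℤ) r r' = 2 * d} ↦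
      ∃ g : (B₀.prod ((-(2 * d : ℤ)) • LinearMap.mul ℤ ℤ)).IsometryEquiv (B₀.prod ((-(2 * d : ℤ)) • LinearMap.mul ℤ ℤ)),
        g.discriminantGroupCongr = LinearEquiv.refl ℤ _ ∧ g r.1 = s.1) = 2 ^ d.primeFactors.card := by
  haveI : NeZero (2 * d) := ⟨by omega⟩
  rw [← natCard_zmod_two_mul_sq_sub_one_dvd hd]
  have h2d : (2 * d : ℤ) ≠ 0 := by exact_mod_cast (by omega : 2 * d ≠ 0)
  have hcast : ((2 * d : ℕ) : ℤ) = 2 * d := by push_cast; ring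
  -- the complete invariant `x mod 2d`
  let F : {r : M × ℤ // B₀.prod ((-(2 * d : ℤ)) • LinearMap.mul ℤ ℤ) r r = -(2 * d : ℤ) ∧
      (∀ z, (2 * d : ℤ) ∣ B₀.prod ((-(2 * d : ℤ)) • LinearMap.mul ℤ ℤ) r z) ∧
        ∃ r', B₀.prod ((-(2 * d : ℤ)) • LinearMap.mul ℤ ℤ) r r' = 2 * d} →
      {u : ZMod (2 * d) // (4 * d : ℤ) ∣ (u.val : ℤ) ^ 2 - 1} :=
    fun r ↦ ⟨(r.1.2 : ZMod (2 * d)),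
      (four_mul_dvd_val_intCast_sq_sub_one_iff d hd _).2 (four_mul_dvd_snd_sq_sub_one d hu he hd r.2.1 r.2.2.1)⟩
  have key : ∀ r s : {r : M × ℤ // B₀.prod ((-(2 * d : ℤ)) • LinearMap.mul ℤ ℤ) r r = -(2 * d : ℤ) ∧
      (∀ z, (2 * d : ℤ) ∣ B₀.prod ((-(2 * d : ℤ)) • LinearMap.mul ℤ ℤ) r z) ∧
        ∃ r', B₀.prod ((-(2 * d : ℤ)) • LinearMap.mul ℤ ℤ) r r' = 2 * d},
      (∃ g : (B₀.prod ((-(2 * d : ℤ)) • LinearMap.mul ℤ ℤ)).IsometryEquiv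
          (B₀.prod ((-(2 * d : ℤ)) • LinearMap.mul ℤ ℤ)),
        g.discriminantGroupCongr = LinearEquiv.refl ℤ _ ∧ g r.1 = s.1) ↔ F r = F s := by
    rintro ⟨r, hr, hdr, r', hr'⟩ ⟨s, hs, hds, s', hs'⟩
    rw [exists_stable_isometryEquiv_apply_eq_iff_dvd_snd_sub_snd d hu he hd h h2d (hr.trans hs.symm) hdr hds hr'
      hs', Subtype.ext_iff]
    change _ ↔ (r.2 : ZMod (2 * d)) = (s.2 : ZMod (2 * d))
    rw [ZMod.intCast_eq_intCast_iff_dvd_sub, hcast, dvd_sub_comm]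
  refine Nat.card_congr (Equiv.ofBijective (Quot.lift F fun r s hrs ↦ (key r s).1 hrs) ⟨?_, ?_⟩)
  · rintro ⟨r⟩ ⟨s⟩ hrs
    exact Quot.sound ((key r s).2 hrs)
  · rintro ⟨uu, huu⟩
    obtain ⟨r, r', hr2, hrr, hrr', hdiv⟩ :=
      exists_snd_eq_and_apply_self_eq_neg_of_four_mul_dvd d h (ξ := (uu.val : ℤ)) huu
    refine ⟨Quot.mk _ ⟨r, hrr, hdiv, r', hrr'⟩, Subtype.ext ?_⟩
    change (r.2 : ZMod (2 * d)) = uu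
    rw [hr2, Int.cast_natCast, ZMod.natCast_zmod_val]

/-- **GHS Prop. 2.4 (iv), `div(r) = d`: the `Õ(B₀ ⊕ ⟨−2d⟩)`-orbits of `(−2d)`-vectors `r` with `(r, L) = dℤ` are in
bijection with `{x mod d : x² ≡ 1 mod d}` via the `h`-coordinate** ("the number of solutions
`{x mod d | x² ≡ 1 mod d}` is as stated" — evaluated in §4).
[cite: GritsenkoHulekSankaran2008Proportionality, Prop. 2.4 (iv) and proof, b)] -/
theorem natCard_quot_stable_isometryEquiv_neg_twoMul_of_divisor (hu : B₀.IsUnimodular) (he : B₀.IsEven)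
    (hd : 0 < d) {x y x₁ y₁ : M} (h : TwoHyperbolicPairs B₀ x y x₁ y₁) :
    Nat.card (Quot fun r s : {r : M × ℤ // B₀.prod ((-(2 * d : ℤ)) • LinearMap.mul ℤ ℤ) r r = -(2 * d : ℤ) ∧
        (∀ z, (d : ℤ) ∣ B₀.prod ((-(2 * d : ℤ)) • LinearMap.mul ℤ ℤ) r z) ∧
          ∃ r', B₀.prod ((-(2 * d : ℤ)) • LinearMap.mul ℤ ℤ) r r' = d} ↦
      ∃ g : (B₀.prod ((-(2 * d : ℤ)) • LinearMap.mul ℤ ℤ)).IsometryEquiv (B₀.prod ((-(2 * d : ℤ)) • LinearMap.mul ℤ ℤ)),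
        g.discriminantGroupCongr = LinearEquiv.refl ℤ _ ∧ g r.1 = s.1) = Nat.card {u : ZMod d // u ^ 2 = 1} := by
  haveI : NeZero d := ⟨by omega⟩
  have hd0 : (d : ℤ) ≠ 0 := by exact_mod_cast (by omega : d ≠ 0)
  let F : {r : M × ℤ // B₀.prod ((-(2 * d : ℤ)) • LinearMap.mul ℤ ℤ) r r = -(2 * d : ℤ) ∧
      (∀ z, (d : ℤ) ∣ B₀.prod ((-(2 * d : ℤ)) • LinearMap.mul ℤ ℤ) r z) ∧
        ∃ r', B₀.prod ((-(2 * d : ℤ)) • LinearMap.mul ℤ ℤ) r r' = d} → {u : ZMod d // u ^ 2 = 1} :=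
    fun r ↦ ⟨(r.1.2 : ZMod d), by
      have h1 := (ZMod.intCast_zmod_eq_zero_iff_dvd (r.1.2 ^ 2 - 1) d).2
        (dvd_snd_sq_sub_one d hu he hd r.2.1 r.2.2.1)
      push_cast at h1
      exact sub_eq_zero.1 h1⟩
  have key : ∀ r s : {r : M × ℤ // B₀.prod ((-(2 * d : ℤ)) • LinearMap.mul ℤ ℤ) r r = -(2 * d : ℤ) ∧
      (∀ z, (d : ℤ) ∣ B₀.prod ((-(2 * d : ℤ)) • LinearMap.mul ℤ ℤ) r z) ∧
        ∃ r', B₀.prod ((-(2 * d : ℤ)) • LinearMap.mul ℤ ℤ) r r' = d},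
      (∃ g : (B₀.prod ((-(2 * d : ℤ)) • LinearMap.mul ℤ ℤ)).IsometryEquiv
          (B₀.prod ((-(2 * d : ℤ)) • LinearMap.mul ℤ ℤ)),
        g.discriminantGroupCongr = LinearEquiv.refl ℤ _ ∧ g r.1 = s.1) ↔ F r = F s := by
    rintro ⟨r, hr, hdr, r', hr'⟩ ⟨s, hs, hds, s', hs'⟩
    rw [exists_stable_isometryEquiv_apply_eq_iff_dvd_snd_sub_snd d hu he hd h hd0 (hr.trans hs.symm) hdr hds hr'
      hs', Subtype.ext_iff]
    change _ ↔ (r.2 : ZMod d) = (s.2 : ZMod d)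
    rw [ZMod.intCast_eq_intCast_iff_dvd_sub, dvd_sub_comm]
  refine Nat.card_congr (Equiv.ofBijective (Quot.lift F fun r s hrs ↦ (key r s).1 hrs) ⟨?_, ?_⟩)
  · rintro ⟨r⟩ ⟨s⟩ hrs
    exact Quot.sound ((key r s).2 hrs)
  · rintro ⟨uu, huu⟩
    have hξ : (d : ℤ) ∣ (uu.val : ℤ) ^ 2 - 1 := by
      refine (ZMod.intCast_zmod_eq_zero_iff_dvd _ d).1 ?_
      push_cast
      rw [ZMod.natCast_zmod_val, huu, sub_self]
    obtain ⟨r, r', hr2, hrr, hrr', hdiv⟩ := exists_snd_eq_and_apply_self_eq_neg_of_dvd d h hξ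
    refine ⟨Quot.mk _ ⟨r, hrr, hdiv, r', hrr'⟩, Subtype.ext ?_⟩
    change (r.2 : ZMod d) = uu
    rw [hr2, Int.cast_natCast, ZMod.natCast_zmod_val]

end Count

/-! ### §4 "The number of solutions `{x mod d | x² ≡ 1 mod d}` is as stated" -/

section Solutions

/-- `{y² = 1}` splits along a ring isomorphism `A ≃ B × C` (Chinese remainder theorem).
[cite: Oguiso2002K3AlmostPrimes, proof of Prop. (1.10) ("The explicit formula follows from the Chinese remainder Theorem")] -/
private theorem natCard_sq_eq_one_eq_mul_of_ringEquiv' {A B C : Type*} [Ring A] [Ring B] [Ring C]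
    (e : A ≃+* B × C) :
    Nat.card {y : A // y ^ 2 = 1} = Nat.card {y : B // y ^ 2 = 1} * Nat.card {y : C // y ^ 2 = 1} := by
  rw [← Nat.card_prod]
  refine Nat.card_congr ((Equiv.subtypeEquiv e.toEquiv fun y ↦ ?_).trans (Equiv.subtypeProdEquivProd))
  change y ^ 2 = 1 ↔ (e y).1 ^ 2 = 1 ∧ (e y).2 ^ 2 = 1
  rw [← e.injective.eq_iff, map_pow, map_one, Prod.ext_iff, Prod.pow_fst, Prod.pow_snd, Prod.fst_one,
    Prod.snd_one]

/-- `y² = 1` has one solution in `ℤ/2`. [cite: GritsenkoHulekSankaran2008Proportionality, Prop. 2.4 (iv) (the case `d ≡ 2 mod 4`)] -/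
theorem natCard_sq_eq_one_zmod_two : Nat.card {y : ZMod 2 // y ^ 2 = 1} = 1 := by
  rw [Nat.card_eq_fintype_card]
  decide

variable (d : ℕ)

/-- **`d ≡ 2 (mod 4)`: `#{x mod d : x² ≡ 1} = 2^{ρ(d)−1}`** (`d = 2m`, `m` odd: `ℤ/d ≃ ℤ/2 × ℤ/m`).
[cite: GritsenkoHulekSankaran2008Proportionality, Prop. 2.4 (iv) ("`2^{ρ(d)−1}` if `d ≡ 2 mod 4`")] -/
theorem natCard_sq_eq_one_zmod_of_mod_four_eq_two (hd : d % 4 = 2) :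
    Nat.card {y : ZMod d // y ^ 2 = 1} = 2 ^ (d.primeFactors.card - 1) := by
  obtain ⟨m, rfl⟩ : ∃ m, d = 2 * m := ⟨d / 2, by omega⟩
  have hm : Odd m := Nat.odd_iff.2 (by omega)
  have hm0 : m ≠ 0 := by rintro rfl; omega
  have hcop : Nat.Coprime 2 m := Nat.coprime_two_left.2 hm
  have h2 : 2 ∉ m.primeFactors := by
    rw [Nat.mem_primeFactors]
    rintro ⟨-, h2m, -⟩
    exact (Nat.not_even_iff_odd.2 hm) (even_iff_two_dvd.2 h2m)
  rw [natCard_sq_eq_one_eq_mul_of_ringEquiv' (ZMod.chineseRemainder hcop), natCard_sq_eq_one_zmod_two, one_mul,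
    natCard_sq_eq_one_zmod_of_odd hm, Nat.primeFactors_mul two_ne_zero hm0, Nat.Prime.primeFactors Nat.prime_two,
    ← Finset.insert_eq, Finset.card_insert_of_notMem h2, Nat.add_sub_cancel]

/-- **`d ≡ 4 (mod 8)`: `#{x mod d : x² ≡ 1} = 2^{ρ(d)}`** (`d = 4n`, `n` odd: `2^{ρ(n)+1}` solutions and
`ρ(d) = ρ(n) + 1`). [cite: GritsenkoHulekSankaran2008Proportionality, Prop. 2.4 (iv) ("`2^{ρ(d)}` if `d` is odd or `d ≡ 4 mod 8`")] -/
theorem natCard_sq_eq_one_zmod_of_mod_eight_eq_four (hd : d % 8 = 4) :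
    Nat.card {y : ZMod d // y ^ 2 = 1} = 2 ^ d.primeFactors.card := by
  obtain ⟨n, rfl⟩ : ∃ n, d = 4 * n := ⟨d / 4, by omega⟩
  have hn : Odd n := Nat.odd_iff.2 (by omega)
  have hn0 : n ≠ 0 := by rintro rfl; omega
  have h2 : 2 ∉ n.primeFactors := by
    rw [Nat.mem_primeFactors]
    rintro ⟨-, h2n, -⟩
    exact (Nat.not_even_iff_odd.2 hn) (even_iff_two_dvd.2 h2n)
  rw [natCard_sq_eq_one_zmod_four_mul (Nat.pos_of_ne_zero hn0), Nat.primeFactors_mul (by norm_num) hn0,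
    show (4 : ℕ) = 2 ^ 2 from rfl, Nat.primeFactors_prime_pow two_ne_zero Nat.prime_two, ← Finset.insert_eq,
    Finset.card_insert_of_notMem h2]

/-- **`d ≡ 0 (mod 8)`: `#{x mod d : x² ≡ 1} = 2^{ρ(d)+1}`** (`d = 4n`, `n` even: `2^{ρ(n)+1}` solutions and
`ρ(d) = ρ(n)`). [cite: GritsenkoHulekSankaran2008Proportionality, Prop. 2.4 (iv) ("`2^{ρ(d)+1}` if `d ≡ 0 mod 8`")] -/
theorem natCard_sq_eq_one_zmod_of_eight_dvd (hd0 : 0 < d) (hd : 8 ∣ d) :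
    Nat.card {y : ZMod d // y ^ 2 = 1} = 2 ^ (d.primeFactors.card + 1) := by
  obtain ⟨n, rfl⟩ : ∃ n, d = 4 * n := ⟨d / 4, by omega⟩
  have hn0 : n ≠ 0 := by rintro rfl; omega
  have h2 : 2 ∈ n.primeFactors := Nat.mem_primeFactors.2 ⟨Nat.prime_two, by omega, hn0⟩
  rw [natCard_sq_eq_one_zmod_four_mul (Nat.pos_of_ne_zero hn0), Nat.primeFactors_mul (by norm_num) hn0,
    show (4 : ℕ) = 2 ^ 2 from rfl, Nat.primeFactors_prime_pow two_ne_zero Nat.prime_two, ← Finset.insert_eq,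
    Finset.insert_eq_of_mem h2]

/-- **`d` odd: `#{x mod d : x² ≡ 1} = 2^{ρ(d)}`** — the tree's `natCard_sq_eq_one_zmod_of_odd`, recorded here in
GHS's list. [cite: GritsenkoHulekSankaran2008Proportionality, Prop. 2.4 (iv) ("`2^{ρ(d)}` if `d` is odd")] -/
theorem natCard_sq_eq_one_zmod_of_odd' (hd : Odd d) :
    Nat.card {y : ZMod d // y ^ 2 = 1} = 2 ^ d.primeFactors.card :=
  natCard_sq_eq_one_zmod_of_odd hd

end Solutions

/-! ### §5 The model `L_{2d}^{(m)} = (E₈(−1)^{⊕m} ⊕ U^{⊕2}) ⊕ ℤ(−2d)` -/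

section Model

variable (m d : ℕ)

/-- **GHS Prop. 2.4 (iv) for `L_{2d}^{(m)}`, `div(r) = 2d`: "The number of `Õ(L_{2d}^{(m)})`-orbits of
`(−2d)`-vectors with `div(r) = 2d` is `2^{ρ(d)}`"** (`d ≥ 1`; `m = 2` is the K3 lattice `L_{2d}`).
[cite: GritsenkoHulekSankaran2008Proportionality, Prop. 2.4 (iv)] -/
theorem natCard_quot_stable_isometryEquiv_latticeL2dm_neg_twoMul_of_divisor_twoMul (hd : 0 < d) :
    Nat.card (Quot fun r s : {r : ((Fin m → Fin 8 → ℤ) × ((Fin 2 → ℤ) × (Fin 2 → ℤ))) × ℤ //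
        (((LinearMap.BilinForm.pi fun _ : Fin m ↦ -e8Form).prod (hyperbolicSum 2)).prod
          ((-(2 * d : ℤ)) • LinearMap.mul ℤ ℤ)) r r = -(2 * d : ℤ) ∧
        (∀ z, (2 * d : ℤ) ∣ (((LinearMap.BilinForm.pi fun _ : Fin m ↦ -e8Form).prod (hyperbolicSum 2)).prod
          ((-(2 * d : ℤ)) • LinearMap.mul ℤ ℤ)) r z) ∧
        ∃ r', (((LinearMap.BilinForm.pi fun _ : Fin m ↦ -e8Form).prod (hyperbolicSum 2)).prod
          ((-(2 * d : ℤ)) • LinearMap.mul ℤ ℤ)) r r' = 2 * d} ↦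
      ∃ g : ((((LinearMap.BilinForm.pi fun _ : Fin m ↦ -e8Form).prod (hyperbolicSum 2)).prod
          ((-(2 * d : ℤ)) • LinearMap.mul ℤ ℤ))).IsometryEquiv
          ((((LinearMap.BilinForm.pi fun _ : Fin m ↦ -e8Form).prod (hyperbolicSum 2)).prod
          ((-(2 * d : ℤ)) • LinearMap.mul ℤ ℤ))),
        g.discriminantGroupCongr = LinearEquiv.refl ℤ _ ∧ g r.1 = s.1) = 2 ^ d.primeFactors.card := by
  obtain ⟨-, heB, huB⟩ := isSymm_isEven_isUnimodular_pi_neg_e8Form_prod_hyperbolicSum_two m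
  exact natCard_quot_stable_isometryEquiv_neg_twoMul_of_divisor_twoMul d huB heB hd
    (twoHyperbolicPairs_pi_neg_e8Form_prod_hyperbolicSum_two m)

/-- **GHS Prop. 2.4 (iv) for `L_{2d}^{(m)}`, `div(r) = d`: the number of `Õ(L_{2d}^{(m)})`-orbits of `(−2d)`-vectors with
`div(r) = d` is `#{x mod d : x² ≡ 1 mod d}`** — `= 2^{ρ(d)}` (`d` odd or `d ≡ 4 mod 8`), `2^{ρ(d)+1}` (`d ≡ 0 mod 8`),
`2^{ρ(d)−1}` (`d ≡ 2 mod 4`) by §4. [cite: GritsenkoHulekSankaran2008Proportionality, Prop. 2.4 (iv)] -/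
theorem natCard_quot_stable_isometryEquiv_latticeL2dm_neg_twoMul_of_divisor (hd : 0 < d) :
    Nat.card (Quot fun r s : {r : ((Fin m → Fin 8 → ℤ) × ((Fin 2 → ℤ) × (Fin 2 → ℤ))) × ℤ //
        (((LinearMap.BilinForm.pi fun _ : Fin m ↦ -e8Form).prod (hyperbolicSum 2)).prod
          ((-(2 * d : ℤ)) • LinearMap.mul ℤ ℤ)) r r = -(2 * d : ℤ) ∧
        (∀ z, (d : ℤ) ∣ (((LinearMap.BilinForm.pi fun _ : Fin m ↦ -e8Form).prod (hyperbolicSum 2)).prod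
          ((-(2 * d : ℤ)) • LinearMap.mul ℤ ℤ)) r z) ∧
        ∃ r', (((LinearMap.BilinForm.pi fun _ : Fin m ↦ -e8Form).prod (hyperbolicSum 2)).prod
          ((-(2 * d : ℤ)) • LinearMap.mul ℤ ℤ)) r r' = d} ↦
      ∃ g : ((((LinearMap.BilinForm.pi fun _ : Fin m ↦ -e8Form).prod (hyperbolicSum 2)).prod
          ((-(2 * d : ℤ)) • LinearMap.mul ℤ ℤ))).IsometryEquiv
          ((((LinearMap.BilinForm.pi fun _ : Fin m ↦ -e8Form).prod (hyperbolicSum 2)).prod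
          ((-(2 * d : ℤ)) • LinearMap.mul ℤ ℤ))),
        g.discriminantGroupCongr = LinearEquiv.refl ℤ _ ∧ g r.1 = s.1) = Nat.card {u : ZMod d // u ^ 2 = 1} := by
  obtain ⟨-, heB, huB⟩ := isSymm_isEven_isUnimodular_pi_neg_e8Form_prod_hyperbolicSum_two m
  exact natCard_quot_stable_isometryEquiv_neg_twoMul_of_divisor d huB heB hd
    (twoHyperbolicPairs_pi_neg_e8Form_prod_hyperbolicSum_two m)

end Model

end Literature.Topology.FourManifolds

end
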